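import Summits.Ventures.Crystal3D.Theorems.StickyWulffConstantPolycrystalWulffBoundRadialMassOuter
import Summits.Ventures.Crystal3D.Theorems.StickyWulffConstantPolycrystalWulffBoundGenericShiftGrid55

/-!
# `PolycrystalWulffBound`, line `PolyDensity`: the GENERIC SHIFT LEMMA at `θ = 11/20` (three radial
# shells) — across a wall between two ARBITRARY lattices the cdf shift is at most `0.55`
# (crux `stmt-Ventures-19482`; thread L-2 «generic-charge relaxation» of cf-p1 §87.0)

Route `StickyWulffConstant` of the venture `Summits/Ventures/Crystal3D`, second prover lane (poly-p2,
gen 15).  Sharpening of `cruxWulffBody_cap_shift_three_fifths` by one more rotation-invariant number,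
the mass of `W(X)` outside `B̄(0, 53/25)` (`≤ 0.1832`, fourteen caps, `…RadialMassOuter`): for EVERY pair
of frames `A, B`, every unit normal `n` and every level `s`,

  `|W(A) ∩ {s + 11/20 < ⟪y,n⟫}| ≤ |W(B) ∩ {s < ⟪y,n⟫}|`   (`cruxWulffBody_cap_shift_eleven_twentieths`),

i.e. the P side of the route is consistent with any generic charge `c₀ ≥ 0.55` — below the census-free
generic charge `≈ 0.55–0.59` lane G reports for its W1 ledgers.  Same architecture as the `3/5` file:
upper envelopes `cap₂ + 0.969` (q ≤ 2), `cap_{53/25} + 0.092` (q ≤ 53/25), `cap_{√5}`; lower envelopes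
`cap₂ − π(64/3 − 12√3)`, `cap_{√3}`; the fourteen numerical facts of `…GenericShiftGrid55` on the grid
`0, .324, …, 1.664, 1.6861`; empty cap above `√5`, median for `s ∈ [−11/40, 0]`, complements for
`s < −11/40`.  NUMBERS (memo P-L2-g15 §2): this three-shell certificate is worth `0.520`; the limit of
the radial-shell argument is the sharp `√5 − √3 = 0.504`.
WHAT THIS IS NOT: the sharp constant; a statement about co-axial pairs; the crux is not claimed.
-/

noncomputable section

open scoped BigOperators InnerProductSpace ENNReal Pointwise
open MeasureTheory Set

namespace Summit.Ventures.Crystal3D.Theorems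

open Summit.Ventures.Crystal3D.Cruxes.TextureLiminf.TexShadow (E3)

open Literature.MathematicalPhysics.StatisticalMechanics (fccStacking)

/-! ### One grid step at a general shift -/

/-- A grid step at shift `θ`: if `a ≤ s ≤ b`, `a_A(a + θ) ≤ u ≤ l ≤ a_B(b)` then `a_A(s + θ) ≤ a_B(s)`. -/
theorem cruxWulffBody_cap_shift_of_bounds' (A B : E3 ≃ₗᵢ[ℝ] E3) (n : E3) {θ s a b u l : ℝ}
    (ha : a ≤ s) (hb : s ≤ b)
    (hU : volume ({y : E3 | ∀ ν : E3, ⟪y, ν⟫_ℝ ≤ Real.sqrt 2 / 4 *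
        ∑ᶠ w ∈ {w | w ∈ fccStacking 1 (Real.sqrt (2 / 3)) ∧ ‖w‖ = 1}, |⟪w, A.symm ν⟫_ℝ|} ∩
        {y : E3 | a + θ < ⟪y, n⟫_ℝ}) ≤ ENNReal.ofReal u)
    (hul : u ≤ l)
    (hL : ENNReal.ofReal l ≤ volume ({y : E3 | ∀ ν : E3, ⟪y, ν⟫_ℝ ≤ Real.sqrt 2 / 4 *
        ∑ᶠ w ∈ {w | w ∈ fccStacking 1 (Real.sqrt (2 / 3)) ∧ ‖w‖ = 1}, |⟪w, B.symm ν⟫_ℝ|} ∩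
        {y : E3 | b < ⟪y, n⟫_ℝ})) :
    volume ({y : E3 | ∀ ν : E3, ⟪y, ν⟫_ℝ ≤ Real.sqrt 2 / 4 *
        ∑ᶠ w ∈ {w | w ∈ fccStacking 1 (Real.sqrt (2 / 3)) ∧ ‖w‖ = 1}, |⟪w, A.symm ν⟫_ℝ|} ∩
        {y : E3 | s + θ < ⟪y, n⟫_ℝ}) ≤
      volume ({y : E3 | ∀ ν : E3, ⟪y, ν⟫_ℝ ≤ Real.sqrt 2 / 4 *
        ∑ᶠ w ∈ {w | w ∈ fccStacking 1 (Real.sqrt (2 / 3)) ∧ ‖w‖ = 1}, |⟪w, B.symm ν⟫_ℝ|} ∩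
        {y : E3 | s < ⟪y, n⟫_ℝ}) := by
  calc volume ({y : E3 | ∀ ν : E3, ⟪y, ν⟫_ℝ ≤ Real.sqrt 2 / 4 *
        ∑ᶠ w ∈ {w | w ∈ fccStacking 1 (Real.sqrt (2 / 3)) ∧ ‖w‖ = 1}, |⟪w, A.symm ν⟫_ℝ|} ∩
        {y : E3 | s + θ < ⟪y, n⟫_ℝ})
      ≤ volume ({y : E3 | ∀ ν : E3, ⟪y, ν⟫_ℝ ≤ Real.sqrt 2 / 4 *
        ∑ᶠ w ∈ {w | w ∈ fccStacking 1 (Real.sqrt (2 / 3)) ∧ ‖w‖ = 1}, |⟪w, A.symm ν⟫_ℝ|} ∩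
        {y : E3 | a + θ < ⟪y, n⟫_ℝ}) :=
        measure_mono (inter_subset_inter_right _ fun y (hy : s + θ < ⟪y, n⟫_ℝ) => by
          show a + θ < ⟪y, n⟫_ℝ; linarith)
    _ ≤ ENNReal.ofReal u := hU
    _ ≤ ENNReal.ofReal l := ENNReal.ofReal_le_ofReal hul
    _ ≤ volume ({y : E3 | ∀ ν : E3, ⟪y, ν⟫_ℝ ≤ Real.sqrt 2 / 4 *
        ∑ᶠ w ∈ {w | w ∈ fccStacking 1 (Real.sqrt (2 / 3)) ∧ ‖w‖ = 1}, |⟪w, B.symm ν⟫_ℝ|} ∩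
        {y : E3 | b < ⟪y, n⟫_ℝ}) := hL
    _ ≤ volume ({y : E3 | ∀ ν : E3, ⟪y, ν⟫_ℝ ≤ Real.sqrt 2 / 4 *
        ∑ᶠ w ∈ {w | w ∈ fccStacking 1 (Real.sqrt (2 / 3)) ∧ ‖w‖ = 1}, |⟪w, B.symm ν⟫_ℝ|} ∩
        {y : E3 | s < ⟪y, n⟫_ℝ}) :=
        measure_mono (inter_subset_inter_right _ fun y (hy : b < ⟪y, n⟫_ℝ) => by
          show s < ⟪y, n⟫_ℝ; linarith)

/-! ### The generic shift lemma at `θ = 11/20` -/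

/-- **Generic cdf shift ≤ 11/20, the half-line `s ≥ −11/40`.** -/
theorem cruxWulffBody_cap_shift_eleven_twentieths_of_ge (A B : E3 ≃ₗᵢ[ℝ] E3) {n : E3} (hn : ‖n‖ = 1)
    {s : ℝ} (hs : -11 / 40 ≤ s) :
    volume ({y : E3 | ∀ ν : E3, ⟪y, ν⟫_ℝ ≤ Real.sqrt 2 / 4 *
        ∑ᶠ w ∈ {w | w ∈ fccStacking 1 (Real.sqrt (2 / 3)) ∧ ‖w‖ = 1}, |⟪w, A.symm ν⟫_ℝ|} ∩
        {y : E3 | s + 11 / 20 < ⟪y, n⟫_ℝ}) ≤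
      volume ({y : E3 | ∀ ν : E3, ⟪y, ν⟫_ℝ ≤ Real.sqrt 2 / 4 *
        ∑ᶠ w ∈ {w | w ∈ fccStacking 1 (Real.sqrt (2 / 3)) ∧ ‖w‖ = 1}, |⟪w, B.symm ν⟫_ℝ|} ∩
        {y : E3 | s < ⟪y, n⟫_ℝ}) := by
  set WA : Set E3 := {y : E3 | ∀ ν : E3, ⟪y, ν⟫_ℝ ≤ Real.sqrt 2 / 4 *
        ∑ᶠ w ∈ {w | w ∈ fccStacking 1 (Real.sqrt (2 / 3)) ∧ ‖w‖ = 1}, |⟪w, A.symm ν⟫_ℝ|} with hWA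
  set WB : Set E3 := {y : E3 | ∀ ν : E3, ⟪y, ν⟫_ℝ ≤ Real.sqrt 2 / 4 *
        ∑ᶠ w ∈ {w | w ∈ fccStacking 1 (Real.sqrt (2 / 3)) ∧ ‖w‖ = 1}, |⟪w, B.symm ν⟫_ℝ|} with hWB
  obtain ⟨h3lo, h3hi, h5lo, h5hi, -, -, -, -, -, -, -, -⟩ := shift_grid_constants
  have h5pos : 0 < Real.sqrt 5 := Real.sqrt_pos.2 (by norm_num)
  have h3pos : 0 < Real.sqrt 3 := Real.sqrt_pos.2 (by norm_num)
  have hR : (2 : ℝ) ≤ (53 : ℝ) / 25 := by norm_num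
  by_cases htop : (1.6861 : ℝ) ≤ s
  · have hempty : WA ∩ {y : E3 | s + 11 / 20 < ⟪y, n⟫_ℝ} = ∅ := by
      ext y
      simp only [mem_inter_iff, mem_setOf_eq, mem_empty_iff_false, iff_false, not_and, not_lt]
      intro hy
      have hy5 : ‖y‖ ≤ Real.sqrt 5 := mem_closedBall_zero_iff.1 (cruxWulffBody_subset_closedBall A hy)
      have h1 : ⟪y, n⟫_ℝ ≤ ‖y‖ * ‖n‖ := real_inner_le_norm _ _
      rw [hn, mul_one] at h1
      linarith
    rw [hempty, measure_empty]
    exact bot_le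
  rw [not_le] at htop
  by_cases h0 : s < 0
  · calc volume (WA ∩ {y : E3 | s + 11 / 20 < ⟪y, n⟫_ℝ})
        ≤ volume (WA ∩ {y : E3 | (11 : ℝ) / 40 < ⟪y, n⟫_ℝ}) :=
          measure_mono (inter_subset_inter_right _ fun y (hy : s + 11 / 20 < ⟪y, n⟫_ℝ) => by
            show (11 : ℝ) / 40 < ⟪y, n⟫_ℝ; linarith)
      _ ≤ ENNReal.ofReal (Real.pi * (16 / 3 - 4 * ((11 : ℝ) / 40) + ((11 : ℝ) / 40) ^ 3 / 3) +
            (16 + 16 * Real.pi - 12 * Real.pi * Real.sqrt 3)) :=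
          volume_cruxWulffBody_cap_le_shell A hn (q := (11 : ℝ) / 40) (by norm_num) (by norm_num)
      _ ≤ ENNReal.ofReal 16 := ENNReal.ofReal_le_ofReal shift55_grid_median
      _ = volume (WB ∩ {y : E3 | 0 < ⟪y, n⟫_ℝ}) := (volume_cruxWulffBody_cap_zero B hn).symm
      _ ≤ volume (WB ∩ {y : E3 | s < ⟪y, n⟫_ℝ}) :=
          measure_mono (inter_subset_inter_right _ fun y (hy : 0 < ⟪y, n⟫_ℝ) => by
            show s < ⟪y, n⟫_ℝ; linarith)
  rw [not_lt] at h0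
  by_cases hc1 : s ≤ (0.324 : ℝ)
  · exact cruxWulffBody_cap_shift_of_bounds' A B n (θ := 11 / 20) h0 hc1
      (volume_cruxWulffBody_cap_le_shell A hn (q := ((0 : ℝ) + 11 / 20)) (by norm_num) (by norm_num))
      shift55_grid_1
      (volume_cruxWulffBody_cap_ge_shell B hn (q := (0.324 : ℝ)) (by norm_num) (by linarith))
  by_cases hc2 : s ≤ (0.623 : ℝ)
  · exact cruxWulffBody_cap_shift_of_bounds' A B n (θ := 11 / 20) (le_of_lt (not_le.1 hc1)) hc2
      (volume_cruxWulffBody_cap_le_shell A hn (q := ((0.324 : ℝ) + 11 / 20)) (by norm_num) (by norm_num))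
      shift55_grid_2
      (volume_cruxWulffBody_cap_ge_shell B hn (q := (0.623 : ℝ)) (by norm_num) (by linarith))
  by_cases hc3 : s ≤ (0.88 : ℝ)
  · exact cruxWulffBody_cap_shift_of_bounds' A B n (θ := 11 / 20) (le_of_lt (not_le.1 hc2)) hc3
      (volume_cruxWulffBody_cap_le_shell A hn (q := ((0.623 : ℝ) + 11 / 20)) (by norm_num) (by norm_num))
      shift55_grid_3
      (volume_cruxWulffBody_cap_ge_shell B hn (q := (0.88 : ℝ)) (by norm_num) (by linarith))
  by_cases hc4 : s ≤ (1.075 : ℝ)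
  · exact cruxWulffBody_cap_shift_of_bounds' A B n (θ := 11 / 20) (le_of_lt (not_le.1 hc3)) hc4
      (volume_cruxWulffBody_cap_le_shell A hn (q := ((0.88 : ℝ) + 11 / 20)) (by norm_num) (by norm_num))
      shift55_grid_4
      (volume_cruxWulffBody_cap_ge_shell B hn (q := (1.075 : ℝ)) (by norm_num) (by linarith))
  by_cases hc5 : s ≤ (1.219 : ℝ)
  · exact cruxWulffBody_cap_shift_of_bounds' A B n (θ := 11 / 20) (le_of_lt (not_le.1 hc4)) hc5
      (volume_cruxWulffBody_cap_le_outerShell A hn (R := (53 : ℝ) / 25) (q := ((1.075 : ℝ) + 11 / 20)) hR (by norm_num) (by norm_num))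
      shift55_grid_5
      (volume_cruxWulffBody_cap_ge_shell B hn (q := (1.219 : ℝ)) (by norm_num) (by linarith))
  by_cases hc6 : s ≤ (1.317 : ℝ)
  · exact cruxWulffBody_cap_shift_of_bounds' A B n (θ := 11 / 20) (le_of_lt (not_le.1 hc5)) hc6
      (volume_cruxWulffBody_cap_le_outerShell A hn (R := (53 : ℝ) / 25) (q := ((1.219 : ℝ) + 11 / 20)) hR (by norm_num) (by norm_num))
      shift55_grid_6
      (volume_cruxWulffBody_cap_ge_shell B hn (q := (1.317 : ℝ)) (by norm_num) (by linarith))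
  by_cases hc7 : s ≤ (1.417 : ℝ)
  · exact cruxWulffBody_cap_shift_of_bounds' A B n (θ := 11 / 20) (le_of_lt (not_le.1 hc6)) hc7
      (volume_cruxWulffBody_cap_le_outerShell A hn (R := (53 : ℝ) / 25) (q := ((1.317 : ℝ) + 11 / 20)) hR (by norm_num) (by norm_num))
      shift55_grid_7
      ((le_of_eq (volume_closedBall_inter_ioi hn h3pos (by linarith) (by linarith)).symm).trans
        (volume_ball_cap_le_cruxWulffBody B n (1.417 : ℝ)))
  by_cases hc8 : s ≤ (1.513 : ℝ)
  · exact cruxWulffBody_cap_shift_of_bounds' A B n (θ := 11 / 20) (le_of_lt (not_le.1 hc7)) hc8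
      (volume_cruxWulffBody_cap_le_outerShell A hn (R := (53 : ℝ) / 25) (q := ((1.417 : ℝ) + 11 / 20)) hR (by norm_num) (by norm_num))
      shift55_grid_8
      ((le_of_eq (volume_closedBall_inter_ioi hn h3pos (by linarith) (by linarith)).symm).trans
        (volume_ball_cap_le_cruxWulffBody B n (1.513 : ℝ)))
  by_cases hc9 : s ≤ (1.581 : ℝ)
  · exact cruxWulffBody_cap_shift_of_bounds' A B n (θ := 11 / 20) (le_of_lt (not_le.1 hc8)) hc9
      (volume_cruxWulffBody_cap_le_outerShell A hn (R := (53 : ℝ) / 25) (q := ((1.513 : ℝ) + 11 / 20)) hR (by norm_num) (by norm_num))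
      shift55_grid_9
      ((le_of_eq (volume_closedBall_inter_ioi hn h3pos (by linarith) (by linarith)).symm).trans
        (volume_ball_cap_le_cruxWulffBody B n (1.581 : ℝ)))
  by_cases hc10 : s ≤ (1.607 : ℝ)
  · exact cruxWulffBody_cap_shift_of_bounds' A B n (θ := 11 / 20) (le_of_lt (not_le.1 hc9)) hc10
      ((volume_cruxWulffBody_cap_le_ball A n ((1.581 : ℝ) + 11 / 20)).trans (le_of_eq
        (volume_closedBall_inter_ioi hn h5pos (by linarith) (by linarith))))
      shift55_grid_10
      ((le_of_eq (volume_closedBall_inter_ioi hn h3pos (by linarith) (by linarith)).symm).trans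
        (volume_ball_cap_le_cruxWulffBody B n (1.607 : ℝ)))
  by_cases hc11 : s ≤ (1.635 : ℝ)
  · exact cruxWulffBody_cap_shift_of_bounds' A B n (θ := 11 / 20) (le_of_lt (not_le.1 hc10)) hc11
      ((volume_cruxWulffBody_cap_le_ball A n ((1.607 : ℝ) + 11 / 20)).trans (le_of_eq
        (volume_closedBall_inter_ioi hn h5pos (by linarith) (by linarith))))
      shift55_grid_11
      ((le_of_eq (volume_closedBall_inter_ioi hn h3pos (by linarith) (by linarith)).symm).trans
        (volume_ball_cap_le_cruxWulffBody B n (1.635 : ℝ)))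
  by_cases hc12 : s ≤ (1.664 : ℝ)
  · exact cruxWulffBody_cap_shift_of_bounds' A B n (θ := 11 / 20) (le_of_lt (not_le.1 hc11)) hc12
      ((volume_cruxWulffBody_cap_le_ball A n ((1.635 : ℝ) + 11 / 20)).trans (le_of_eq
        (volume_closedBall_inter_ioi hn h5pos (by linarith) (by linarith))))
      shift55_grid_12
      ((le_of_eq (volume_closedBall_inter_ioi hn h3pos (by linarith) (by linarith)).symm).trans
        (volume_ball_cap_le_cruxWulffBody B n (1.664 : ℝ)))
  exact cruxWulffBody_cap_shift_of_bounds' A B n (θ := 11 / 20) (le_of_lt (not_le.1 hc12)) htop.le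
    ((volume_cruxWulffBody_cap_le_ball A n ((1.664 : ℝ) + 11 / 20)).trans (le_of_eq
        (volume_closedBall_inter_ioi hn h5pos (by linarith) (by linarith))))
    shift55_grid_13
    ((le_of_eq (volume_closedBall_inter_ioi hn h3pos (by linarith) (by linarith)).symm).trans
        (volume_ball_cap_le_cruxWulffBody B n (1.6861 : ℝ)))

/-- **Generic cdf shift ≤ 11/20**: for all frames `A, B`, unit `n` and `s`,
`|W(A) ∩ {s + 11/20 < ⟪y,n⟫}| ≤ |W(B) ∩ {s < ⟪y,n⟫}|`.  The half-line `s < −11/40` follows from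
`s' = −s − 11/20 ≥ −11/40` with the frames swapped, by `a_X(τ) + a_X(−τ) = 32`. -/
theorem cruxWulffBody_cap_shift_eleven_twentieths (A B : E3 ≃ₗᵢ[ℝ] E3) {n : E3} (hn : ‖n‖ = 1) (s : ℝ) :
    volume ({y : E3 | ∀ ν : E3, ⟪y, ν⟫_ℝ ≤ Real.sqrt 2 / 4 *
        ∑ᶠ w ∈ {w | w ∈ fccStacking 1 (Real.sqrt (2 / 3)) ∧ ‖w‖ = 1}, |⟪w, A.symm ν⟫_ℝ|} ∩
        {y : E3 | s + 11 / 20 < ⟪y, n⟫_ℝ}) ≤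
      volume ({y : E3 | ∀ ν : E3, ⟪y, ν⟫_ℝ ≤ Real.sqrt 2 / 4 *
        ∑ᶠ w ∈ {w | w ∈ fccStacking 1 (Real.sqrt (2 / 3)) ∧ ‖w‖ = 1}, |⟪w, B.symm ν⟫_ℝ|} ∩
        {y : E3 | s < ⟪y, n⟫_ℝ}) := by
  by_cases hs : -11 / 40 ≤ s
  · exact cruxWulffBody_cap_shift_eleven_twentieths_of_ge A B hn hs
  rw [not_le] at hs
  have hA := volume_cruxWulffBody_cap_add_cap_neg A hn (s + 11 / 20)
  have hB := volume_cruxWulffBody_cap_add_cap_neg B hn s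
  have haux := cruxWulffBody_cap_shift_eleven_twentieths_of_ge B A hn (s := -s - 11 / 20) (by linarith)
  have heq : -s - 11 / 20 + 11 / 20 = -s := by ring
  rw [heq] at haux
  have heq2 : -(s + 11 / 20) = -s - 11 / 20 := by ring
  rw [heq2] at hA
  set aA := volume ({y : E3 | ∀ ν : E3, ⟪y, ν⟫_ℝ ≤ Real.sqrt 2 / 4 *
        ∑ᶠ w ∈ {w | w ∈ fccStacking 1 (Real.sqrt (2 / 3)) ∧ ‖w‖ = 1}, |⟪w, A.symm ν⟫_ℝ|} ∩
        {y : E3 | s + 11 / 20 < ⟪y, n⟫_ℝ}) with haA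
  set aA' := volume ({y : E3 | ∀ ν : E3, ⟪y, ν⟫_ℝ ≤ Real.sqrt 2 / 4 *
        ∑ᶠ w ∈ {w | w ∈ fccStacking 1 (Real.sqrt (2 / 3)) ∧ ‖w‖ = 1}, |⟪w, A.symm ν⟫_ℝ|} ∩
        {y : E3 | -s - 11 / 20 < ⟪y, n⟫_ℝ}) with haA'
  set aB := volume ({y : E3 | ∀ ν : E3, ⟪y, ν⟫_ℝ ≤ Real.sqrt 2 / 4 *
        ∑ᶠ w ∈ {w | w ∈ fccStacking 1 (Real.sqrt (2 / 3)) ∧ ‖w‖ = 1}, |⟪w, B.symm ν⟫_ℝ|} ∩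
        {y : E3 | s < ⟪y, n⟫_ℝ}) with haB
  set aB' := volume ({y : E3 | ∀ ν : E3, ⟪y, ν⟫_ℝ ≤ Real.sqrt 2 / 4 *
        ∑ᶠ w ∈ {w | w ∈ fccStacking 1 (Real.sqrt (2 / 3)) ∧ ‖w‖ = 1}, |⟪w, B.symm ν⟫_ℝ|} ∩
        {y : E3 | -s < ⟪y, n⟫_ℝ}) with haB'
  have hA'top : aA' ≠ ⊤ := by
    intro ht; rw [ht, add_top] at hA; exact ENNReal.ofReal_ne_top hA.symm
  have hB'top : aB' ≠ ⊤ := by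
    intro ht; rw [ht, add_top] at hB; exact ENNReal.ofReal_ne_top hB.symm
  have h1 : aA = ENNReal.ofReal 32 - aA' := ENNReal.eq_sub_of_add_eq hA'top hA
  have h2 : aB = ENNReal.ofReal 32 - aB' := ENNReal.eq_sub_of_add_eq hB'top hB
  rw [h1, h2]
  exact tsub_le_tsub_left haux _

end Summit.Ventures.Crystal3D.Theorems

end
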